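import Literature.NumberTheory.Automorphic.HilbertModularGaloisRepProofs
import Literature.NumberTheory.GaloisRepresentations.WeilLAdicCharacterProofs
import Literature.NumberTheory.GaloisRepresentations.HeckeCharacterOfGrossencharakter
import Literature.NumberTheory.Automorphic.CompletedCohomologyHeckeAlgebraGLn
import HarnessLib

/-!
# Reducible rank-two Galois representations from pairs of Größencharaktere

Topic `NumberTheory/Automorphic`; namespaces `Literature.NumberTheory.GaloisRepresentations`
(Größencharaktere, Galois characters) and `Literature.NumberTheory.Automorphic` (the Hecke
polynomial).  Theorems only — the Galois-side plumbing of Harder's theorem on boundary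
eigensystems (`BianchiOrdinaryClassicality.bianchi_boundaryEigensystem_isReducible`):

* `IsGrossencharakter.inv` — the inverse of an algebraic Größencharakter is one (type `(-p, -q)`);
* `exists_galoisCharacter_of_isGrossencharakter` — Weil's `ℓ`-adic character of a Größencharakter
  (`HeckeCharacter.exists_of_isGrossencharakter` + `HeckeCharacter.IsAlgebraic.exists_lAdic`):
  unramified at `v ∤ ℓ 𝔣` with Frobenius polynomial `X - ι⁻¹(ψ(v))⁻¹`;
* `FramedGaloisRep.exists_sum_of_characters` — `τ₁ ⊕ τ₂` is semisimple, reducible, unramified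
  where both `τ_i` are, with Frobenius polynomial the product (`FramedRep.exists_diagonal_two`);
* `heckeFrobPoly_two_eq` — `X² - a₁ X + N a₂ = (X - α)(X - β)` when `a₁ = α + β`, `N a₂ = α β`.
[cite: Harder1987, §2]

## References

* G. Harder, *Eisenstein cohomology of arithmetic groups. The case GL₂*, Invent. Math. 89 (1987), §2
  [Harder1987].
* A. Weil, *On a certain type of characters of the idèle-class group of an algebraic number-field*
  (1956), §1 [Weil1956].
-/

noncomputable section

open scoped NumberField Polynomial ComplexConjugate
open NumberField IsDedekindDomain Polynomial Field

namespace Literature.NumberTheory.GaloisRepresentations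

/-! ### Inverse of a Größencharakter -/

section Gross

variable {K : Type} [Field K] [NumberField K] {𝔣 : Ideal (𝓞 K)} {p q : InfinitePlace K → ℤ}
  {ψ : HeightOneSpectrum (𝓞 K) → ℂ}

/-- `idealPow ψ⁻¹ I = (idealPow ψ I)⁻¹`. [folklore] -/
theorem idealPow_inv (ψ : HeightOneSpectrum (𝓞 K) → ℂ) (I : Ideal (𝓞 K)) :
    LFunctions.idealPow K (fun v => (ψ v)⁻¹) I = (LFunctions.idealPow K ψ I)⁻¹ := by
  rw [LFunctions.idealPow, LFunctions.idealPow, ← finprod_inv_distrib]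
  exact finprod_congr fun v => inv_pow _ _

/-- **The inverse of an algebraic Größencharakter is an algebraic Größencharakter** of infinity
type `(-p, -q)`. [folklore] -/
theorem IsGrossencharakter.inv (hψ : IsGrossencharakter 𝔣 p q ψ) :
    IsGrossencharakter 𝔣 (fun w => -p w) (fun w => -q w) (fun v => (ψ v)⁻¹) := by
  refine ⟨fun v hv => inv_ne_zero (hψ.ne_zero v hv), fun b c hb hc hcop hbc hpos => ?_⟩
  rw [idealPow_inv, idealPow_inv, hψ.idealPow_span_eq b c hb hc hcop hbc hpos, mul_inv,
    ← Finset.prod_inv_distrib]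
  refine congrArg _ (Finset.prod_congr rfl fun w _ => ?_)
  rw [mul_inv, zpow_neg, zpow_neg]

/-! ### Weil's `ℓ`-adic character of a Größencharakter -/

/-- **The `ℓ`-adic Galois character of an algebraic Größencharakter.**  For a Größencharakter
`ψ` modulo `𝔣 ≠ 0` of type `(p, q)` and `ι : ℚ̄_ℓ ≃ ℂ` there is a continuous character
`r : Γ_K → GL₁(ℚ̄_ℓ)`, unramified at every `v ∤ ℓ` with `𝔣 ≰ v`, whose arithmetic Frobenius
there has characteristic polynomial `X - ι⁻¹(ψ(v))⁻¹`. [cite: Weil1956, §1] -/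
theorem exists_galoisCharacter_of_isGrossencharakter (h𝔣 : 𝔣 ≠ ⊥) (hψ : IsGrossencharakter 𝔣 p q ψ)
    {ℓ : ℕ} [Fact ℓ.Prime] (ι : PadicAlgCl ℓ ≃+* ℂ) :
    ∃ r : FramedGaloisRep K (PadicAlgCl ℓ) 1, ∀ v : HeightOneSpectrum (𝓞 K),
      ((ℓ : ℕ) : 𝓞 K) ∉ v.asIdeal → ¬ 𝔣 ≤ v.asIdeal →
        r.IsUnramifiedAt v ∧ r.HasFrobCharpolyAt v (X - C (ι.symm (ψ v)⁻¹)) := by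
  obtain ⟨ω, hωpq, hω⟩ := HeckeCharacter.exists_of_isGrossencharakter h𝔣 hψ
  have halg : ω.IsAlgebraic := ω.isAlgebraic_iff_exists_hasInfinityType.2 ⟨p, q, hωpq⟩
  obtain ⟨r, hr⟩ := halg.exists_lAdic ι
  refine ⟨r, fun v hvℓ hv => ?_⟩
  obtain ⟨hunr, hval⟩ := hω v hv
  have := hr v hvℓ hunr
  rwa [hval] at this

end Gross

/-! ### The sum of two characters -/

section Sum

variable {K : Type*} [Field K] {A : Type*} [Field A] [TopologicalSpace A] [IsTopologicalRing A]

/-- **`τ₁ ⊕ τ₂` as a framed rank-two Galois representation**: semisimple, not irreducible,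
unramified wherever both `τ_i` are, with Frobenius characteristic polynomial the product of
those of `τ₁` and `τ₂`. [folklore] -/
theorem FramedGaloisRep.exists_sum_of_characters (τ₁ τ₂ : FramedGaloisRep K A 1) :
    ∃ s : FramedGaloisRep K A 2, s.toGaloisRep.IsSemisimple ∧ ¬ s.toGaloisRep.IsIrreducible ∧
      ∀ v : HeightOneSpectrum (𝓞 K), τ₁.IsUnramifiedAt v → τ₂.IsUnramifiedAt v →
        s.IsUnramifiedAt v ∧ ∀ P₁ P₂ : Polynomial A, τ₁.HasFrobCharpolyAt v P₁ →
          τ₂.HasFrobCharpolyAt v P₂ → s.HasFrobCharpolyAt v (P₁ * P₂) := by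
  obtain ⟨s, hs⟩ := FramedRep.exists_diagonal_two (FramedRep.det τ₁) (FramedRep.det τ₂)
  set d : absoluteGaloisGroup K → Fin 2 → A := fun g =>
    ![((FramedRep.det τ₁ g : Aˣ) : A), ((FramedRep.det τ₂ g : Aˣ) : A)] with hd
  have hs' : ∀ g, ((s g : GL (Fin 2) A) : Matrix (Fin 2) (Fin 2) A) = Matrix.diagonal (d g) :=
    fun g => hs g
  have hdet : ∀ (τ : FramedGaloisRep K A 1) (g : absoluteGaloisGroup K),
      ((FramedRep.det τ g : Aˣ) : A) = ((Matrix.GeneralLinearGroup.det (τ g) : Aˣ) : A) := fun τ g => rfl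
  refine ⟨s, FramedRep.isSemisimpleRepresentation_of_diagonal_two s d hs',
    FramedRep.not_isIrreducible_of_diagonal_two s d hs', fun v h₁ h₂ => ⟨?_, ?_⟩⟩
  · intro 𝔓 h𝔓 σ hσ
    refine Units.ext ?_
    rw [hs' σ, Units.val_one]
    have : d σ = 1 := by
      ext i
      fin_cases i
      · change ((FramedRep.det τ₁ σ : Aˣ) : A) = 1
        rw [hdet, h₁ 𝔓 h𝔓 σ hσ, map_one, Units.val_one]
      · change ((FramedRep.det τ₂ σ : Aˣ) : A) = 1
        rw [hdet, h₂ 𝔓 h𝔓 σ hσ, map_one, Units.val_one]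
    rw [this]
    exact Matrix.diagonal_one
  · intro P₁ P₂ hP₁ hP₂ 𝔓 h𝔓 σ hσ
    rw [FramedRep.charpoly_of_diagonal_two s d hs' σ, ← hP₁ 𝔓 h𝔓 σ hσ, ← hP₂ 𝔓 h𝔓 σ hσ,
      charpoly_eq_X_sub_C_det, charpoly_eq_X_sub_C_det]
    rfl

end Sum

end Literature.NumberTheory.GaloisRepresentations

namespace Literature.NumberTheory.Automorphic

/-! ### The rank-two Hecke polynomial -/

/-- **`X² - a₁ X + N a₂ = (X - α)(X - β)`** when `a₁ = α + β` and `N a₂ = α β`: the Hecke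
polynomial `heckeFrobPoly 2 N a` of `CompletedCohomologyHeckeAlgebraGLn` factors through the
Frobenius eigenvalues. [folklore] -/
theorem heckeFrobPoly_two_eq {A : Type*} [CommRing A] (N : ℕ) (a : ℕ → A) (α β : A)
    (h₁ : a 1 = α + β) (h₂ : (N : A) * a 2 = α * β) :
    BigHeckeGLn.heckeFrobPoly 2 N a = (X - C α) * (X - C β) := by
  rw [BigHeckeGLn.heckeFrobPoly, show Finset.Icc 1 2 = {1, 2} from rfl, Finset.sum_pair (by decide)]
  norm_num
  rw [h₁, show (N : A[X]) * C (a 2) = C ((N : A) * a 2) by rw [map_mul, map_natCast], h₂]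
  simp only [map_add, map_mul]
  ring

end Literature.NumberTheory.Automorphic
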